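import Summits.ValiantsHypothesis.ValiantsHypothesis.Theses.LacunarySymmetroid
import Summits.ValiantsHypothesis.ValiantsHypothesis.Theorems.PencilTransfer.Negative.PencilTransferFalseWithoutIsVPFamily
import Summits.ValiantsHypothesis.ValiantsHypothesis.Theorems.LacunarySymmetroidThetaWitness
import Literature.Barriers.ValiantsHypothesis.TauRealZeros
import Literature.Computability.AlgebraicComplexity.RealTauConjectureDepthFour
import Literature.Computability.AlgebraicComplexity.ArithCircuitProofs

/-!
# Disproof of `PencilTransfer` — findings (cdisprove seat, cycle 1, 2026-08-17)

Crux `Summit.ValiantsHypothesis.ValiantsHypothesis.Theses.LacunarySymmetroid.PencilTransfer`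
(item stmt-ValiantsHypothesis-18051, route `LacunarySymmetroid`, rank 3):

  `∀ v f, IsVPFamily (f ⊗ ℂ) → ∀ d, ∃ c, ∀ n, ∃ m ≤ 2^((⌊log₂ n⌋ + c)^c), ∃ S : Fin (v n + 1) → Symₘ(ℝ),`
  `roots(det Σ_l X^{(0 ∷ d n) l} • S_l).toFinset = roots(f_n(X^{d n i})).toFinset`.

VERDICT OF THIS CYCLE: **no kill — the crux is a theorem** (`dc` quasi-polynomial for `VP`, proved in
tree as `isQPBounded_determinantalComplexity_of_isVPFamily_holds`, then either real descent + GKKP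
symmetrisation giving `det = f_n(X^d)` on the nose — the lead's picked line `real-descent-exact`, a
complete sorry-free proof — or complex pencil → realification `[[B,-C],[C,B]]` (`det = F²`) → symmetric
doubling `[[0,R],[Rᵀ,0]]` (`det = F⁴`)). Junk cases are harmless: `roots 0 = ∅` on both sides exactly
when `F ≡ 0`; `v n = 0`, constant families, `d ≡ 0` all hold with `m = 0`.

What this file records instead is WHICH PARTS OF THE HYPOTHESIS CARRY THE LOAD (everything below is
kernel-checked, no `sorry`):

* (a1) `pencilTransfer_false_without_isVPFamily'` — whole hypothesis dropped: FALSE (landed by the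
  crux-attack seat, `Theorems/PencilTransfer/Negative/PencilTransferFalseWithoutIsVPFamily.lean`,
  re-exported here).
* (a2) `pencilTransfer_false_without_degreeBound` — only the p-bounded DEGREE clause of `IsPFamily`
  dropped (variable bound and p-computability of `f ⊗ ℂ` kept): FALSE. Witness = the wall's own
  witness, the Chebyshev tower `T_{2^n}(x₀)` (`τ ≤ 3n`, `2^n` real zeros; barrier file `TauRealZeros`).
  So the `TauRealZeros` wall re-enters the crux exactly through the degree clause. (LANDED:
  `Theorems/PencilTransfer/Negative/PencilTransferFalseWithoutDegreeBound.lean`, p145225 ACCEPTED.)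
* (a3) `PencilTransferWithoutVarsBound` — only the `#vars` clause dropped: TRUE (not load-bearing; the
  `dc` theorem discards it: `obtain ⟨⟨-, hdegp⟩, hLp⟩`). Recorded as a remark, no theorem (positive).
* (a4) `pencilTransfer_false_without_complexityBound_of_matrixDescartes` — only the p-COMPUTABILITY
  clause dropped (hypothesis = `IsPFamily (f ⊗ ℂ)`): FALSE MODULO THE ROUTE'S OTHER CRUX
  `MatrixDescartes`. Reason: `ThetaWitness` is now PROVED in tree (`thetaWitness_proof`); its `Θ` is a
  `VNP` family, hence a p-family, so the complexity-free transfer applies to `Θ` directly and the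
  assembly arithmetic of `closes` yields `False` from `MatrixDescartes` — no `VP = VNP` needed.
  Contrapositive for provers/planners: a proof of `PencilTransfer` that does not use
  `IsPComputable` would REFUTE `MatrixDescartes`. (LANDED:
  `Theorems/PencilTransfer/Negative/PencilTransferComplexityClause.lean`, p145434 ACCEPTED —
  `matrixDescartes_contradiction`, `pencilTransfer_false_without_complexityBound_of_matrixDescartes`.)
  Unconditionally the status of (a4) is OPEN and is an
  MDR-type question (real zeros of p-families on monomial curves vs. symmetric lacunary pencils).
* (b) TIGHTNESS `pencilTransfer_size_ge`: in the two-term sector (`v = 1`, `d = 1`) every admissible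
  pencil has `m ≥ #real zeros` (`deg det (X • S₁ + S₀) ≤ m`), attained up to the factor in `dc` by the
  diagonal pencil; hence `not_pencilTransferConstSize` (no `n`-independent size) and
  `not_pencilTransferUniform` (no single `c` for all `VP` families — small-`n` slack: at `n = 0` the
  bound is `2^(c^c)`; the EVENTUAL uniform version holds with `c = 3`). (LANDED:
  `Theorems/PencilTransfer/Negative/PencilTransferSizeTightness.lean`, p145431 ACCEPTED.)
* (c) STRENGTHENINGS: `not_pencilTransferNoConstTerm` — the constant-term slot `Fin.cons 0` is
  load-bearing (`det (X^d • S) = X^{dm} det S` only vanishes at `0`). NOT refutable (true): exact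
  determinant `det = f_n(X^d)` with symmetric real `S` (real descent + GKKP), equality of root
  MULTISETS, `c` independent of `d`, `IsVPFamily` weakened to `IsVQPFamily`. OPEN: polynomial size
  `m ≤ n^c + c` (again MDR-type).
* (d) Targets: none (payload `stuck_stubs = []`; the picked line is a complete proof).
* (e) Near-misses: none.

The lemmas below DUPLICATE the landed files' proofs (this work file was written before they landed and
must elaborate against the then-current tree); `Disproof.next.lean` in the seat folder is the
import-based version, to be published once the farm has built the three new modules.

Dead ends (one line each): small/finite models — none exist (statement is asymptotic in `n` with
`∃ c`); junk models (`v = 0`, `f = 0`, `F ≡ 0`, `d ≡ 0`) — conclusion holds with `m = 0`/`S = 0`;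
`n` vs `v(n)` exponent slip — harmless (`IsPFamily` bounds `v n ≤ n^a + a`, `dc` bound is in `n`);
size slip `4·dc` — absorbed by `c ↦ c + 2`.
-/

-- `Summit.ValiantsHypothesis.ValiantsHypothesis.…` is the tree's mandated single-conjunct layout.
set_option linter.dupNamespace false

namespace Summit.ValiantsHypothesis.ValiantsHypothesis.Cruxes.PencilTransfer.Disproof

open Polynomial Literature.Computability.AlgebraicComplexity Literature.Barriers.ValiantsHypothesis
open Summit.ValiantsHypothesis.ValiantsHypothesis.Theses.LacunarySymmetroid
open Summit.ValiantsHypothesis.Theorems.PencilTransfer.Negative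

/-- The conclusion of `PencilTransfer` for a given family `(v, f)` and exponents `d` (verbatim). [folklore] -/
abbrev Conclusion (v : ℕ → ℕ) (f : ∀ n, MvPolynomial (Fin (v n)) ℝ) (d : (n : ℕ) → Fin (v n) → ℕ) :
    Prop :=
  ∃ c : ℕ, ∀ n : ℕ, ∃ m : ℕ, m ≤ 2 ^ ((Nat.log 2 n + c) ^ c) ∧
    ∃ S : Fin (v n + 1) → Matrix (Fin m) (Fin m) ℝ, (∀ l, (S l).IsSymm) ∧
      (Matrix.det (∑ l, ((Polynomial.X : Polynomial ℝ) ^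
          (Fin.cons (α := fun _ => ℕ) (0 : ℕ) (d n) l)) • (S l).map Polynomial.C)).roots.toFinset =
      (MvPolynomial.aeval (fun i => (Polynomial.X : Polynomial ℝ) ^ d n i) (f n)).roots.toFinset

/-- Read-back: the crux is literally `∀ v f, IsVPFamily (f ⊗ ℂ) → ∀ d, Conclusion v f d`. [folklore] -/
theorem pencilTransfer_iff :
    PencilTransfer ↔ ∀ (v : ℕ → ℕ) (f : ∀ n, MvPolynomial (Fin (v n)) ℝ),
      IsVPFamily (fun n => MvPolynomial.map (algebraMap ℝ ℂ) (f n)) →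
      ∀ d : (n : ℕ) → Fin (v n) → ℕ, Conclusion v f d :=
  Iff.rfl

/-! ## (a) Load-bearing analysis of the hypothesis `IsVPFamily (f ⊗ ℂ)`

`IsVPFamily g = (IsPBounded #vars ∧ IsPBounded deg) ∧ IsPComputable g`. -/

/-- (a1) The crux with its whole hypothesis dropped. [folklore] -/
def PencilTransferWithoutIsVPFamily : Prop :=
  ∀ (v : ℕ → ℕ) (f : ∀ n, MvPolynomial (Fin (v n)) ℝ) (d : (n : ℕ) → Fin (v n) → ℕ), Conclusion v f d

/-- (a1) **FALSE without the hypothesis** (landed: `pencilTransfer_false_without_isVPFamily`, witness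
`∏_{j<2^((2n)^n)+1} (x₀ - j)` along `x₀ = X` versus `deg det (X • S₁ + S₀) ≤ m`). [folklore] -/
theorem pencilTransfer_false_without_isVPFamily' : ¬ PencilTransferWithoutIsVPFamily :=
  fun h => pencilTransfer_false_without_isVPFamily fun v f d => h v f d

/-- (a2) The crux with only the DEGREE clause of `IsPFamily` dropped. [folklore] -/
def PencilTransferWithoutDegreeBound : Prop :=
  ∀ (v : ℕ → ℕ) (f : ∀ n, MvPolynomial (Fin (v n)) ℝ),
    IsPBounded (fun n => Fintype.card (Fin (v n))) →
    IsPComputable (fun n => MvPolynomial.map (algebraMap ℝ ℂ) (f n)) →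
    ∀ d : (n : ℕ) → Fin (v n) → ℕ, Conclusion v f d

/-- The complexification of the real Chebyshev tower `T_{2^n}(x₀) ⊗ ℂ` is the integer tower over `ℂ`. [folklore] -/
theorem map_chebFamily (n : ℕ) :
    MvPolynomial.map (algebraMap ℝ ℂ) (MvPolynomial.map (Int.castRingHom ℝ) (chebyshevT n)) =
      MvPolynomial.map (Int.castRingHom ℂ) (chebyshevT n) := by
  rw [MvPolynomial.map_map]
  congr 1

/-- `L_ℂ(T_{2^n}) ≤ τ(T_{2^n}) ≤ 3n` (barrier file). [cite: Koiran2011, §1 (p. 3)] -/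
theorem complexity_map_chebFamily_le (n : ℕ) :
    complexity (MvPolynomial.map (algebraMap ℝ ℂ)
      (MvPolynomial.map (Int.castRingHom ℝ) (chebyshevT n))) ≤ 3 * n := by
  rw [map_chebFamily]
  exact (ArithCircuit.complexity_map_le_constantFreeComplexity _ _).trans
    (constantFreeComplexity_chebyshevT_le n)

/-- The complexified Chebyshev tower is p-computable (`3n ≤ n² + 2`). [folklore] -/
theorem isPComputable_chebFamily :
    IsPComputable (fun n => MvPolynomial.map (algebraMap ℝ ℂ)
      (MvPolynomial.map (Int.castRingHom ℝ) (chebyshevT n))) := by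
  refine ⟨2, fun n => (complexity_map_chebFamily_le n).trans ?_⟩
  rcases n with _ | _ | n
  · simp
  · norm_num
  · nlinarith [Nat.zero_le n]

/-- Restriction of the real tower along `x₀ = X¹` is `T_{2^n} ∈ ℝ[X]`. [folklore] -/
theorem aeval_chebFamily (n : ℕ) :
    MvPolynomial.aeval (fun _ : Fin 1 => (X : ℝ[X]) ^ 1)
      (MvPolynomial.map (Int.castRingHom ℝ) (chebyshevT n)) =
      (Chebyshev.T ℤ ((2 ^ n : ℕ) : ℤ)).map (Int.castRingHom ℝ) := by
  have key : ((MvPolynomial.aeval (fun _ : Fin 1 => (X : ℝ[X]) ^ 1)).toRingHom.comp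
      ((MvPolynomial.map (Int.castRingHom ℝ)).comp
        (MvPolynomial.uniqueAlgEquiv ℤ (Fin 1)).symm.toAlgHom.toRingHom)) =
      Polynomial.mapRingHom (Int.castRingHom ℝ) := by
    apply Polynomial.ringHom_ext'
    · exact RingHom.ext_int _ _
    · simp [MvPolynomial.uniqueAlgEquiv_symm_apply]
  have h := RingHom.congr_fun key (Chebyshev.T ℤ ((2 ^ n : ℕ) : ℤ))
  simpa [chebyshevT] using h

/-- `2^n` distinct real zeros along the curve. [cite: Koiran2011, §1 (p. 3)] -/
theorem card_roots_toFinset_aeval_chebFamily (n : ℕ) :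
    (MvPolynomial.aeval (fun _ : Fin 1 => (X : ℝ[X]) ^ 1)
      (MvPolynomial.map (Int.castRingHom ℝ) (chebyshevT n))).roots.toFinset.card = 2 ^ n := by
  rw [aeval_chebFamily, card_realRoots_chebyshevT]

/-- Growth bookkeeping: `(t + c)^c < 2^t` for some `t ≥ 1`. [folklore] -/
theorem exists_add_pow_lt_two_pow (c : ℕ) : ∃ t : ℕ, 1 ≤ t ∧ (t + c) ^ c < 2 ^ t := by
  obtain ⟨T₀, hT⟩ := eventually_mul_pow_lt_two_pow c ((c + 1) ^ c)
  refine ⟨max T₀ 1, le_max_right _ _, ?_⟩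
  set t : ℕ := max T₀ 1 with ht
  have ht1 : 1 ≤ t := le_max_right _ _
  calc (t + c) ^ c ≤ ((c + 1) * t) ^ c := Nat.pow_le_pow_left (by nlinarith) c
    _ = (c + 1) ^ c * t ^ c := by rw [mul_pow]
    _ < 2 ^ t := hT t (le_max_left _ _)

/-- (a2) **The DEGREE clause is load-bearing**: `PencilTransferWithoutDegreeBound` is false — Chebyshev
tower `T_{2^n}(x₀)`, `d = 1`: complexity `≤ 3n`, `2^n` real zeros, but `m ≤ 2^((log₂ n + c)^c) < 2^n` at
`n = 2^t`. Any proof of the crux must use `IsPBounded deg` (it is what makes `dc` quasi-polynomial).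
[cite: Koiran2011, §1 (p. 3)] -/
theorem pencilTransfer_false_without_degreeBound : ¬ PencilTransferWithoutDegreeBound := by
  intro h
  obtain ⟨c, hc⟩ := h (fun _ => 1) (fun n => MvPolynomial.map (Int.castRingHom ℝ) (chebyshevT n))
    ⟨1, fun n => by simp⟩ isPComputable_chebFamily (fun _ _ => 1)
  obtain ⟨t, -, hlt⟩ := exists_add_pow_lt_two_pow c
  obtain ⟨m, hm, S, -, hroots⟩ := hc (2 ^ t)
  have hR := card_roots_toFinset_aeval_chebFamily (2 ^ t)
  rw [← hroots] at hR
  have hle := card_roots_toFinset_twoTermPencil_le m S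
  rw [hR] at hle
  rw [Nat.log_pow (by norm_num : 1 < 2)] at hm
  have h2 : 2 ^ ((t + c) ^ c) < 2 ^ (2 ^ t) := Nat.pow_lt_pow_right (by norm_num) hlt
  omega

/-- (a3) The crux with only the `#vars` clause dropped. TRUE, i.e. NOT load-bearing: the tree proof of
`isQPBounded_determinantalComplexity_of_isVPFamily_holds` never uses the variable bound, and neither
does the rest of the chain (recorded for provers: `IsPFamily.1` may be discarded). No theorem is stated
here (a positive statement is the provers' lane). [folklore] -/
def PencilTransferWithoutVarsBound : Prop :=
  ∀ (v : ℕ → ℕ) (f : ∀ n, MvPolynomial (Fin (v n)) ℝ),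
    IsPBounded (fun n => (MvPolynomial.map (algebraMap ℝ ℂ) (f n)).totalDegree) →
    IsPComputable (fun n => MvPolynomial.map (algebraMap ℝ ℂ) (f n)) →
    ∀ d : (n : ℕ) → Fin (v n) → ℕ, Conclusion v f d

/-- (a4) The crux with only the p-COMPUTABILITY clause dropped (hypothesis = p-family). [folklore] -/
def PencilTransferWithoutComplexityBound : Prop :=
  ∀ (v : ℕ → ℕ) (f : ∀ n, MvPolynomial (Fin (v n)) ℝ),
    IsPFamily (fun n => MvPolynomial.map (algebraMap ℝ ℂ) (f n)) →
    ∀ d : (n : ℕ) → Fin (v n) → ℕ, Conclusion v f d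

/-- The assembly arithmetic of `closes`, isolated: `MatrixDescartes`, a family with
`2^{n⌊log₂ n⌋} - 1` real zeros along a curve eventually, and a transferred pencil family for it are
contradictory (verbatim tail of `LacunarySymmetroid.closes`). [folklore] -/
theorem mdr_contradiction (hMDR : MatrixDescartes) {Θ : ∀ n : ℕ, MvPolynomial (Fin n) ℝ}
    {d : ∀ n : ℕ, Fin n → ℕ} {n₀ : ℕ}
    (hroots : ∀ n : ℕ, n₀ ≤ n → 2 ^ (n * Nat.log 2 n) ≤
      (MvPolynomial.aeval (fun i => (Polynomial.X : Polynomial ℝ) ^ d n i) (Θ n)).roots.toFinset.card + 1)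
    (hc : Conclusion (fun n => n) Θ d) : False := by
  obtain ⟨c, hc⟩ := hc
  obtain ⟨K₀, hK⟩ := hMDR c 4 (by norm_num)
  obtain ⟨n, hn₀, hnK, hn4⟩ : ∃ n, n₀ ≤ n ∧ K₀ ≤ n ∧ 4 ≤ n := ⟨n₀ + K₀ + 4, by omega, by omega, by omega⟩
  obtain ⟨m, hm, S, hS, hroot⟩ := hc n
  set Z := (MvPolynomial.aeval (fun i => (Polynomial.X : Polynomial ℝ) ^ d n i) (Θ n)).roots.toFinset.card
    with hZ
  have hm' : m ≤ 2 ^ ((Nat.log 2 (n + 1) + c) ^ c) :=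
    hm.trans (Nat.pow_le_pow_right (by norm_num)
      (Nat.pow_le_pow_left (Nat.add_le_add_right (Nat.log_mono_right (Nat.le_succ n)) c) c))
  have h1 := hK (n + 1) m (by omega) hm' (Fin.cons (α := fun _ => ℕ) (0 : ℕ) (d n)) S hS
  rw [hroot] at h1
  have h2 : 2 ^ (n * Nat.log 2 n) ≤ Z + 1 := hroots n hn₀
  set L := Nat.log 2 n with hL
  have hL2 : 2 ≤ L := by
    rw [hL]
    calc 2 = Nat.log 2 4 := by decide
      _ ≤ Nat.log 2 n := Nat.log_mono_right hn4
  have hLn : L ≤ n := by rw [hL]; exact Nat.log_le_self 2 n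
  have hL' : Nat.log 2 (n + 1) ≤ L + 1 := by
    rw [hL]
    calc Nat.log 2 (n + 1) ≤ Nat.log 2 (n * 2) := Nat.log_mono_right (by omega)
      _ = Nat.log 2 n + 1 := Nat.log_mul_base (by norm_num) (by omega)
  have h3 : Z ^ 4 ≤ 2 ^ ((n + 1) * (L + 1)) :=
    h1.trans (Nat.pow_le_pow_right (by norm_num) (Nat.mul_le_mul_left _ hL'))
  have hnL : 1 ≤ n * L := by nlinarith
  have h4 : 2 ^ (n * L - 1) ≤ Z := by
    have e : 2 ^ (n * L) = 2 * 2 ^ (n * L - 1) := by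
      rw [← Nat.pow_succ']
      congr 1
      omega
    have h2' := h2
    rw [e] at h2'
    have : 1 ≤ 2 ^ (n * L - 1) := Nat.one_le_two_pow
    omega
  have h5 : 2 ^ (4 * (n * L - 1)) ≤ Z ^ 4 := by
    rw [pow_mul']
    exact Nat.pow_le_pow_left h4 4
  have h6 : 4 * (n * L - 1) ≤ (n + 1) * (L + 1) :=
    (Nat.pow_le_pow_iff_right (by norm_num)).1 (h5.trans h3)
  have h7 : 6 * n ≤ 3 * (n * L) := by nlinarith
  have h6' : 4 * (n * L - 1) ≤ n * L + n + L + 1 := by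
    have e : (n + 1) * (L + 1) = n * L + n + L + 1 := by ring
    rw [e] at h6
    exact h6
  generalize hP : n * L = P at h6' h7 hnL
  omega

/-- (a4) **The COMPLEXITY clause is load-bearing modulo `MatrixDescartes`**: if the route's other crux
holds, `PencilTransfer` with `IsVPFamily` weakened to `IsPFamily` is false — the PROVED witness of
`ThetaWitness` (`thetaWitness_proof`: a `VNP`, hence p-, family with `2^{n⌊log₂ n⌋} - 1` real zeros on
a monomial curve) would transfer without `VP = VNP`, and the assembly arithmetic closes on `False`.
Contrapositive: a proof of the crux not using `IsPComputable` refutes `MatrixDescartes`. [folklore] -/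
theorem pencilTransfer_false_without_complexityBound_of_matrixDescartes (hMDR : MatrixDescartes) :
    ¬ PencilTransferWithoutComplexityBound := by
  intro hT
  obtain ⟨Θ, d, hVNP, n₀, hroots⟩ :=
    Summit.ValiantsHypothesis.ValiantsHypothesis.Theorems.LacunarySymmetroid.thetaWitness_proof
  exact mdr_contradiction hMDR hroots (hT (fun n => n) Θ hVNP.1 d)

/-- (a4') Equivalently: the complexity-free transfer and `MatrixDescartes` cannot both hold. [folklore] -/
theorem not_matrixDescartes_of_pencilTransferWithoutComplexityBound
    (hT : PencilTransferWithoutComplexityBound) : ¬ MatrixDescartes :=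
  fun hMDR => pencilTransfer_false_without_complexityBound_of_matrixDescartes hMDR hT

/-! ## (b) Tightness of the size bound (two-term sector) -/

/-- Complexification of the product family. [folklore] -/
theorem map_prod_X_sub_natCast (N : ℕ) :
    MvPolynomial.map (algebraMap ℝ ℂ)
        (∏ j ∈ Finset.range N, (MvPolynomial.X 0 - MvPolynomial.C (j : ℝ)) : MvPolynomial (Fin 1) ℝ) =
      ∏ j ∈ Finset.range N, (MvPolynomial.X 0 - MvPolynomial.C (j : ℂ)) := by
  simp [map_prod, MvPolynomial.map_X]

/-- `L(x₀ - c) ≤ 1`. [cite: Burgisser2000, Def. 2.1] -/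
theorem complexity_X_sub_C_le {k : Type*} [CommRing k] (c : k) :
    complexity (MvPolynomial.X (0 : Fin 1) - MvPolynomial.C c : MvPolynomial (Fin 1) k) ≤ 1 := by
  have h := complexity_add_le_holds (k := k) (σ := Fin 1) (MvPolynomial.X 0) (MvPolynomial.C (-c))
  rw [complexity_X_holds, complexity_C_holds, MvPolynomial.C_neg, ← sub_eq_add_neg] at h
  simpa using h

/-- `L(∏_{j<N} (x₀ - j)) ≤ 2N`. [cite: Burgisser2000, §2.1] -/
theorem complexity_prod_X_sub_natCast_le {k : Type*} [CommRing k] (N : ℕ) :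
    complexity (∏ j ∈ Finset.range N, (MvPolynomial.X 0 - MvPolynomial.C (j : k)) :
      MvPolynomial (Fin 1) k) ≤ 2 * N := by
  induction N with
  | zero =>
    rw [Finset.range_zero, Finset.prod_empty, ← MvPolynomial.C_1, complexity_C_holds]
  | succ N ih =>
    rw [Finset.prod_range_succ]
    calc _ ≤ complexity (∏ j ∈ Finset.range N, (MvPolynomial.X 0 - MvPolynomial.C (j : k)) :
              MvPolynomial (Fin 1) k) +
            complexity (MvPolynomial.X (0 : Fin 1) - MvPolynomial.C ((N : ℕ) : k)) + 1 :=
          complexity_mul_le_holds _ _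
      _ ≤ 2 * N + 1 + 1 := by
          have h1 := complexity_X_sub_C_le (k := k) ((N : ℕ) : k)
          omega
      _ = 2 * (N + 1) := by ring

/-- `deg ∏_{j<N} (x₀ - j) ≤ N`. [folklore] -/
theorem totalDegree_prod_X_sub_natCast_le {k : Type*} [CommRing k] [Nontrivial k] (N : ℕ) :
    (∏ j ∈ Finset.range N, (MvPolynomial.X 0 - MvPolynomial.C (j : k)) :
      MvPolynomial (Fin 1) k).totalDegree ≤ N := by
  have h1 : ∀ j : ℕ, (MvPolynomial.X (0 : Fin 1) - MvPolynomial.C (j : k) :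
      MvPolynomial (Fin 1) k).totalDegree ≤ 1 := fun j =>
    (MvPolynomial.totalDegree_sub _ _).trans
      (max_le (MvPolynomial.totalDegree_X (R := k) (0 : Fin 1)).le
        (by rw [MvPolynomial.totalDegree_C]; exact Nat.zero_le 1))
  calc (∏ j ∈ Finset.range N, (MvPolynomial.X 0 - MvPolynomial.C (j : k)) :
        MvPolynomial (Fin 1) k).totalDegree
      ≤ ∑ j ∈ Finset.range N, (MvPolynomial.X (0 : Fin 1) - MvPolynomial.C (j : k) :
          MvPolynomial (Fin 1) k).totalDegree := MvPolynomial.totalDegree_finsetProd _ _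
    _ ≤ ∑ _j ∈ Finset.range N, 1 := Finset.sum_le_sum fun j _ => h1 j
    _ = N := by simp

/-- The product family `∏_{j<N(n)} (x₀ - j)` (`N` p-bounded) is a genuine `VP` family. [cite: Burgisser2000, Def. 2.4] -/
theorem isVPFamily_prod_X_sub_natCast {N : ℕ → ℕ} (hN : IsPBounded N) :
    IsVPFamily (fun n => MvPolynomial.map (algebraMap ℝ ℂ)
      (∏ j ∈ Finset.range (N n), (MvPolynomial.X 0 - MvPolynomial.C (j : ℝ)) :
        MvPolynomial (Fin 1) ℝ)) := by
  refine ⟨⟨⟨1, fun n => by simp⟩, hN.mono fun n => ?_⟩, ?_⟩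
  · dsimp only
    rw [map_prod_X_sub_natCast]
    exact totalDegree_prod_X_sub_natCast_le (k := ℂ) (N n)
  · refine (IsPBounded.mul_holds (IsPBounded.const 2) hN).mono fun n => ?_
    dsimp only
    rw [map_prod_X_sub_natCast]
    exact complexity_prod_X_sub_natCast_le (k := ℂ) (N n)

/-- (b) **Size tightness, `K = 2`**: a two-term pencil with the real zero set of `∏_{j<N} (x₀ - j)`
along `x₀ = X` has size `m ≥ N`. So the crux's `m` is at least the real-zero count of the restriction
for this `VP` family (and `dc = N` attains it up to the constant: diagonal pencil). [folklore] -/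
theorem pencilTransfer_size_ge (N m : ℕ) (S : Fin (1 + 1) → Matrix (Fin m) (Fin m) ℝ)
    (h : (Matrix.det (∑ l, ((X : ℝ[X]) ^ (Fin.cons (α := fun _ => ℕ) (0 : ℕ) (fun _ : Fin 1 => 1) l)) •
        (S l).map C)).roots.toFinset =
      (MvPolynomial.aeval (fun _ : Fin 1 => (X : ℝ[X]) ^ 1)
        (∏ j ∈ Finset.range N, (MvPolynomial.X 0 - MvPolynomial.C (j : ℝ)))).roots.toFinset) :
    N ≤ m := by
  have hR := card_roots_toFinset_prod_X_sub_natCast N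
  rw [← h] at hR
  exact hR ▸ card_roots_toFinset_twoTermPencil_le m S

/-- Strengthening: size bounded by a constant independent of `n`. [folklore] -/
def PencilTransferConstSize : Prop :=
  ∀ (v : ℕ → ℕ) (f : ∀ n, MvPolynomial (Fin (v n)) ℝ),
    IsVPFamily (fun n => MvPolynomial.map (algebraMap ℝ ℂ) (f n)) →
    ∀ d : (n : ℕ) → Fin (v n) → ℕ, ∃ c : ℕ, ∀ n : ℕ, ∃ m : ℕ, m ≤ c ∧
      ∃ S : Fin (v n + 1) → Matrix (Fin m) (Fin m) ℝ, (∀ l, (S l).IsSymm) ∧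
        (Matrix.det (∑ l, ((Polynomial.X : Polynomial ℝ) ^
            (Fin.cons (α := fun _ => ℕ) (0 : ℕ) (d n) l)) • (S l).map Polynomial.C)).roots.toFinset =
        (MvPolynomial.aeval (fun i => (Polynomial.X : Polynomial ℝ) ^ d n i) (f n)).roots.toFinset

/-- (b) **No constant size** (`∏_{j<n} (x₀ - j)`, level `n = c + 1`). [folklore] -/
theorem not_pencilTransferConstSize : ¬ PencilTransferConstSize := by
  intro h
  obtain ⟨c, hc⟩ := h (fun _ => 1)
    (fun n => ∏ j ∈ Finset.range n, (MvPolynomial.X 0 - MvPolynomial.C (j : ℝ)))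
    (isVPFamily_prod_X_sub_natCast IsPBounded.id) (fun _ _ => 1)
  obtain ⟨m, hm, S, -, hroots⟩ := hc (c + 1)
  have := pencilTransfer_size_ge (c + 1) m S hroots
  omega

/-- Strengthening: ONE constant `c` for all `VP` families (`∃ c ∀ f` instead of `∀ f ∃ c`). [folklore] -/
def PencilTransferUniform : Prop :=
  ∃ c : ℕ, ∀ (v : ℕ → ℕ) (f : ∀ n, MvPolynomial (Fin (v n)) ℝ),
    IsVPFamily (fun n => MvPolynomial.map (algebraMap ℝ ℂ) (f n)) →
    ∀ (d : (n : ℕ) → Fin (v n) → ℕ) (n : ℕ), ∃ m : ℕ, m ≤ 2 ^ ((Nat.log 2 n + c) ^ c) ∧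
      ∃ S : Fin (v n + 1) → Matrix (Fin m) (Fin m) ℝ, (∀ l, (S l).IsSymm) ∧
        (Matrix.det (∑ l, ((Polynomial.X : Polynomial ℝ) ^
            (Fin.cons (α := fun _ => ℕ) (0 : ℕ) (d n) l)) • (S l).map Polynomial.C)).roots.toFinset =
        (MvPolynomial.aeval (fun i => (Polynomial.X : Polynomial ℝ) ^ d n i) (f n)).roots.toFinset

/-- (b) **No uniform constant** — small-`n` slack: at `n = 0` the bound is `2^(c^c)`, beaten by the
constant `VP` family `∏_{j<2^(c^c)+1} (x₀ - j)`. (Eventually in `n`, `c = 3` is uniform.) [folklore] -/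
theorem not_pencilTransferUniform : ¬ PencilTransferUniform := by
  rintro ⟨c, hc⟩
  obtain ⟨m, hm, S, -, hroots⟩ := hc (fun _ => 1)
    (fun _ => ∏ j ∈ Finset.range (2 ^ (c ^ c) + 1), (MvPolynomial.X 0 - MvPolynomial.C (j : ℝ)))
    (isVPFamily_prod_X_sub_natCast (IsPBounded.const _)) (fun _ _ => 1) 0
  have h1 := pencilTransfer_size_ge (2 ^ (c ^ c) + 1) m S hroots
  rw [Nat.log_zero_right, zero_add] at hm
  omega

/-! ## (c) Natural strengthenings -/

/-- `det (X^e • S) = X^{e m} · det S`. [folklore] -/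
theorem det_X_pow_smul_map_C (m e : ℕ) (M : Matrix (Fin m) (Fin m) ℝ) :
    Matrix.det (((X : ℝ[X]) ^ e) • M.map C) = (X : ℝ[X]) ^ (e * m) * C (Matrix.det M) := by
  rw [Matrix.det_smul, Fintype.card_fin, ← pow_mul, RingHom.map_det, RingHom.mapMatrix_apply]

/-- `1` is never a root of `det (X^e • S)`. [folklore] -/
theorem one_not_mem_roots_det_X_pow_smul (m e : ℕ) (M : Matrix (Fin m) (Fin m) ℝ) :
    (1 : ℝ) ∉ (Matrix.det (((X : ℝ[X]) ^ e) • M.map C)).roots.toFinset := by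
  rw [det_X_pow_smul_map_C, Multiset.mem_toFinset, Polynomial.mem_roots', Polynomial.IsRoot.def]
  rintro ⟨hne, heval⟩
  simp only [eval_mul, eval_pow, eval_X, one_pow, one_mul, eval_C] at heval
  exact hne (by rw [heval, map_zero, mul_zero])

/-- `1` is a root of `∏_{j<N} (x₀ - j)` along `x₀ = X` for `N ≥ 2`. [folklore] -/
theorem one_mem_roots_aeval_prod (N : ℕ) (hN : 2 ≤ N) :
    (1 : ℝ) ∈ (MvPolynomial.aeval (fun _ : Fin 1 => (X : ℝ[X]) ^ 1)
        (∏ j ∈ Finset.range N, (MvPolynomial.X 0 - MvPolynomial.C (j : ℝ)))).roots.toFinset := by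
  rw [aeval_prod_X_sub_natCast, Polynomial.roots_prod_X_sub_C, Finset.val_toFinset, Finset.mem_image]
  exact ⟨1, Finset.mem_range.2 (by omega), Nat.cast_one⟩

/-- Strengthening: no constant-term slot (`K = v n` terms with exponents `d n` only). [folklore] -/
def PencilTransferNoConstTerm : Prop :=
  ∀ (v : ℕ → ℕ) (f : ∀ n, MvPolynomial (Fin (v n)) ℝ),
    IsVPFamily (fun n => MvPolynomial.map (algebraMap ℝ ℂ) (f n)) →
    ∀ d : (n : ℕ) → Fin (v n) → ℕ, ∃ c : ℕ, ∀ n : ℕ, ∃ m : ℕ, m ≤ 2 ^ ((Nat.log 2 n + c) ^ c) ∧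
      ∃ S : Fin (v n) → Matrix (Fin m) (Fin m) ℝ, (∀ l, (S l).IsSymm) ∧
        (Matrix.det (∑ l, ((Polynomial.X : Polynomial ℝ) ^ (d n l)) • (S l).map Polynomial.C)).roots.toFinset =
        (MvPolynomial.aeval (fun i => (Polynomial.X : Polynomial ℝ) ^ d n i) (f n)).roots.toFinset

/-- (c) **The constant-term slot is load-bearing**: `PencilTransferNoConstTerm` is false
(`∏_{j<n} (x₀ - j)`, `d = 1`, level `n = 2`: `X(X-1)` vanishes at `1`, `det (X • S) = X^m det S` does
not). [folklore] -/
theorem not_pencilTransferNoConstTerm : ¬ PencilTransferNoConstTerm := by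
  intro h
  obtain ⟨c, hc⟩ := h (fun _ => 1)
    (fun n => ∏ j ∈ Finset.range n, (MvPolynomial.X 0 - MvPolynomial.C (j : ℝ)))
    (isVPFamily_prod_X_sub_natCast IsPBounded.id) (fun _ _ => 1)
  obtain ⟨m, -, S, -, hroots⟩ := hc 2
  have h1 := one_mem_roots_aeval_prod 2 le_rfl
  rw [← hroots, Fin.sum_univ_one] at h1
  exact one_not_mem_roots_det_X_pow_smul m 1 (S 0) h1

/-! ## (c') Strengthenings that are NOT refutable (true; recorded for the provers)

* exact determinant: `∃ S symmetric real, det (Σ X^{e_l} S_l) = f_n(X^{d})` at size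
  `m ≤ 2^((log₂ n + c)^c)` — true by real descent (`IsVPFamily (f ⊗ ℂ) → IsVPFamily f`, Hrubeš–Yehudayoff
  realification of circuits) + `dc` over `ℝ` + GKKP symmetrisation; this is the picked line
  `real-descent-exact` (complete proof, being landed). Hence also equality of root MULTISETS.
* `c` independent of `d` (`∃ c ∀ d`): true (the pencil comes from a `d`-free determinantal representation).
* hypothesis weakened to `IsVQPFamily (f ⊗ ℂ)`: true (`VQP` also has quasi-polynomial `dc`).
* OPEN (MDR-type, not attempted): polynomial size `m ≤ n^c + c`; the unconditional status of (a4).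

## (d) Targets — none this cycle (`stuck_stubs = []`).  ## (e) Near-misses — none. -/

end Summit.ValiantsHypothesis.ValiantsHypothesis.Cruxes.PencilTransfer.Disproof
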